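import Summits.AtomisticToContinuum.Crystallization.Theorems.FrustratedLawDichotomyStrainedPatchHomEntryMirrorHcp

/-!
# The hcp half from a `U`-TREE (six entry coordinates only) whose leaf ELIMINATES the shuffle `ξ` — the tree theorem of architecture «R»

decomp-a2c hand-2 g29 (crux `AperiodicFrustratedLawGap`, stmt-AtomisticToContinuum-27623; BUDGET-F critic rows 1085 / 1089: «ARCHITECTURE OF RECORD: U-tree
(dim 6) + ξ-eliminating ring leaf [T | F | E]»).  Every hcp tree theorem so far (`…HomEntryFlipHcp.hcpHalf_of_entryTreeShuf`,
`…HomEntryMirrorHcp.hcpHalf_of_entryTreeWedge`) runs the certificate tree over the TWELVE-coordinate entry/shuffle cube `rootCH ± rootWH`.  The ring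
leaf certifies, for a `U`-box alone, the dichotomy for EVERY shuffle of the fundamental domain; this file books such a leaf through a tree over the
NINE-coordinate entry cube `rootC ± rootW` of the fcc half (`CertTree (Fin 3 × Fin 3)`), with the `D₃ₕ` wedge hypotheses `0 ≤ ξ₀`, `0 ≤ ξ₂`,
`3 ξ₁² ≤ ξ₀²` and `‖ξ‖ ≤ 1/4` handed to the leaf's soundness obligation (the leaf may use or ignore them):

* ★★ `hcpHalf_of_entryUTreeWedge` — generic verdict on `U`-boxes, `hver` relativised to the wedge ⟹ the `hhcp` hypothesis of
  `…HomPrunedPolar.homFloor_of_prunedBoxSums_selfAdjoint` for every `m` with `2 (m + e_W) SC ≤ μ` (via `hcpHalf_of_shufWedge`, ×12);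
* ★★★ `homFloor_of_entryTrees6RBKP_U` / `homFloor_625_of_entryTrees6RBKP_U` — `(H) HomFloor m` from the fcc ∃-tree fact of record and an hcp ∃-`U`-tree
  fact over any such verdict.

The ring leaf itself (`entryLeafOKHT`: [T] fit on the cube `|ξ − ξ_ref|_∞ ≤ h`, [F] `…HomForceRing.hcpForceLJ_exterior` outside it, [E] `…HomConvexExterior` /
the HC leaf) is hand-1's kernel item; its soundness theorem is exactly an `hver` of the shape below.
NO definitions; 0 sorry; standard axioms; no instances / notation / `#eval`.  `--supports stmt-AtomisticToContinuum-27623`.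
-/

namespace Summit.AtomisticToContinuum.Crystallization.Theorems.FrustratedLawDichotomyStrainedPatchHomEntryUTreeHcp

open scoped BigOperators RealInnerProductSpace
open Literature.Analysis.ValidatedNumerics.Numerics
open Summit.AtomisticToContinuum.Crystallization.Theorems.ChargedEnergyGapNegative (E3)
open Summit.AtomisticToContinuum.Crystallization.Theorems.FrustratedLawDichotomySchurCut (effPot w₄₅ ω₄)
open Summit.AtomisticToContinuum.Crystallization.Theorems.FrustratedLawDichotomyAveragingRuleTightFree (TightNearCap BadNearCap)
open Summit.AtomisticToContinuum.Crystallization.Theorems.FrustratedLawDichotomyExemptAbsorption (ExemptNear)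
open Summit.AtomisticToContinuum.Crystallization.Theorems.FrustratedLawDichotomyStrainedPatchHomSplit
open Summit.AtomisticToContinuum.Crystallization.Theorems.FrustratedLawDichotomyStrainedPatchHomPrunedPolar (homFloor_of_prunedBoxSums_selfAdjoint)
open Summit.AtomisticToContinuum.Crystallization.Theorems.FrustratedLawDichotomyStrainedPatchHomCertTree (CertTree treeOK treeOK_sound)
open Summit.AtomisticToContinuum.Crystallization.Theorems.FrustratedLawDichotomyStrainedPatchHomEntryGram
open Summit.AtomisticToContinuum.Crystallization.Theorems.FrustratedLawDichotomyStrainedPatchHomEntryTable (muRec muRec_ok)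
open Summit.AtomisticToContinuum.Crystallization.Theorems.FrustratedLawDichotomyStrainedPatchHomEntryFlipHcp (HcpDich)
open Summit.AtomisticToContinuum.Crystallization.Theorems.FrustratedLawDichotomyStrainedPatchHomEntryMirrorHcp (hcpHalf_of_shufWedge)
open Summit.AtomisticToContinuum.Crystallization.Theorems.FrustratedLawDichotomyStrainedPatchHomEntryTableP (entryLeafOK6RBKP)
open Summit.AtomisticToContinuum.Crystallization.Theorems.FrustratedLawDichotomyStrainedPatchHomEntryTreeCert (fccHalf_of_entryTree6RBKP)

/-- ★★ **THE hcp HALF FROM ONE `U`-TREE WITH A ξ-ELIMINATING LEAF** (generic verdict on the nine entry coordinates; `hver` relativised to the `D₃ₕ`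
wedge `0 ≤ ξ₀`, `0 ≤ ξ₂`, `3 ξ₁² ≤ ξ₀²` and `‖ξ‖ ≤ 1/4`): the `hhcp` hypothesis of `…HomPrunedPolar.homFloor_of_prunedBoxSums_selfAdjoint` verbatim, every `m`
with `2 (m + e_W) SC ≤ μ`. [folklore] -/
theorem hcpHalf_of_entryUTreeWedge {m : ℝ} {μ : ℤ} (hμ : 2 * (m + (-(7175 / 10000) + 3 / 400)) * SC ≤ μ)
    (verdict : (Fin 3 × Fin 3 → ℤ) → (Fin 3 × Fin 3 → ℤ) → Bool)
    (hver : ∀ c w, verdict c w = true → ∀ (U : E3 →L[ℝ] E3) (ξ : E3), (∀ v v' : E3, ⟪U v, v'⟫ = ⟪v, U v'⟫) → ‖U - 1‖ ≤ 1 / 4 →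
      (∀ ab : Fin 3 × Fin 3, |(U (EuclideanSpace.single ab.2 (1 : ℝ))) ab.1 - (c ab : ℝ) / SC| ≤ (w ab : ℝ) / SC) →
      ‖ξ‖ ≤ 1 / 4 → 0 ≤ ξ 0 → 0 ≤ ξ 2 → 3 * (ξ 1) ^ 2 ≤ (ξ 0) ^ 2 →
      (∀ (M : ℕ) (z : Fin M → E3) (c : Fin M), Function.Injective z →
          Set.range z = {x : E3 | dist x (z c) ≤ 133 / 10 ∧ ∃ a : Fin 3 → ℤ,
            x = z c + latPt U hexFrame a ∨ x = z c + latPt U hexFrame a + U (hcpShift + ξ)} →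
          TightNearCap (9 / 5) (3 / 2) z c ∨ ExemptNear (9 / 5) ExRec z c ∨ BadNearCap (9 / 5) (3 / 2) z c) ∨
        (μ : ℝ) / SC ≤ ∑ b ∈ (Fintype.piFinset fun _ : Fin 3 => Finset.Icc (-7 : ℤ) 7).filter (fun b => b ≠ 0), effPot w₄₅ ω₄ (3 / 400) ‖latPt U hexFrame b‖ +
          ∑ b ∈ (Fintype.piFinset fun _ : Fin 3 => Finset.Icc (-7 : ℤ) 7), effPot w₄₅ ω₄ (3 / 400) ‖latPt U hexFrame b + U (hcpShift + ξ)‖)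
    {t : CertTree (Fin 3 × Fin 3)} (h : treeOK verdict t rootC rootW = true) :
    ∀ (U : E3 →L[ℝ] E3) (ξ : E3), (∀ v w : E3, inner ℝ (U v) w = inner ℝ v (U w)) → (∀ w : E3, 0 ≤ inner ℝ w (U w)) →
      ‖U - 1‖ ≤ 1 / 4 → ‖ξ‖ ≤ 1 / 4 → HcpDich m U ξ := by
  refine hcpHalf_of_shufWedge fun U ξ hsa _hpos hU hξ hx0 hx2 hxw => ?_
  have hS := SC_pos
  have key := treeOK_sound SC_pos
    (P := fun x : Fin 3 × Fin 3 → ℝ => ∀ (U : E3 →L[ℝ] E3) (ξ : E3), (∀ v v' : E3, ⟪U v, v'⟫ = ⟪v, U v'⟫) → ‖U - 1‖ ≤ 1 / 4 →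
      (∀ ab : Fin 3 × Fin 3, (U (EuclideanSpace.single ab.2 (1 : ℝ))) ab.1 = x ab) →
      ‖ξ‖ ≤ 1 / 4 → 0 ≤ ξ 0 → 0 ≤ ξ 2 → 3 * (ξ 1) ^ 2 ≤ (ξ 0) ^ 2 →
      (∀ (M : ℕ) (z : Fin M → E3) (c : Fin M), Function.Injective z →
          Set.range z = {x : E3 | dist x (z c) ≤ 133 / 10 ∧ ∃ a : Fin 3 → ℤ,
            x = z c + latPt U hexFrame a ∨ x = z c + latPt U hexFrame a + U (hcpShift + ξ)} →
          TightNearCap (9 / 5) (3 / 2) z c ∨ ExemptNear (9 / 5) ExRec z c ∨ BadNearCap (9 / 5) (3 / 2) z c) ∨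
        (μ : ℝ) / SC ≤ ∑ b ∈ (Fintype.piFinset fun _ : Fin 3 => Finset.Icc (-7 : ℤ) 7).filter (fun b => b ≠ 0), effPot w₄₅ ω₄ (3 / 400) ‖latPt U hexFrame b‖ +
          ∑ b ∈ (Fintype.piFinset fun _ : Fin 3 => Finset.Icc (-7 : ℤ) 7), effPot w₄₅ ω₄ (3 / 400) ‖latPt U hexFrame b + U (hcpShift + ξ)‖)
    verdict (fun c w hv x hx V η hVsa hV1 hVx hη h0 h2 hw => hver c w hv V η hVsa hV1 (fun ab => by rw [hVx ab]; exact hx ab) hη h0 h2 hw)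
    t rootC rootW h (fun ab : Fin 3 × Fin 3 => (U (EuclideanSpace.single ab.2 (1 : ℝ))) ab.1) (mem_root_of_near_one hU) U ξ hsa hU
    (fun _ => rfl) hξ hx0 hx2 hxw
  refine key.imp id fun hfloor => ?_
  have h2 : 2 * (m + (-(7175 / 10000) + 3 / 400)) ≤ (μ : ℝ) / SC := by rw [le_div_iff₀ hS]; exact hμ
  linarith

/-- ★★★ **`(H) HomFloor m` FROM THE fcc ∃-TREE FACT OF RECORD AND AN hcp ∃-`U`-TREE FACT** over any ξ-eliminating leaf verdict sound in the sense of
`hcpHalf_of_entryUTreeWedge`; every `m`, `μ` with `2 (m + e_W) SC ≤ μ`. [folklore] -/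
theorem homFloor_of_entryTrees6RBKP_U {m : ℝ} {μ : ℤ} (hμ : 2 * (m + (-(7175 / 10000) + 3 / 400)) * SC ≤ μ)
    (verdict : (Fin 3 × Fin 3 → ℤ) → (Fin 3 × Fin 3 → ℤ) → Bool)
    (hver : ∀ c w, verdict c w = true → ∀ (U : E3 →L[ℝ] E3) (ξ : E3), (∀ v v' : E3, ⟪U v, v'⟫ = ⟪v, U v'⟫) → ‖U - 1‖ ≤ 1 / 4 →
      (∀ ab : Fin 3 × Fin 3, |(U (EuclideanSpace.single ab.2 (1 : ℝ))) ab.1 - (c ab : ℝ) / SC| ≤ (w ab : ℝ) / SC) →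
      ‖ξ‖ ≤ 1 / 4 → 0 ≤ ξ 0 → 0 ≤ ξ 2 → 3 * (ξ 1) ^ 2 ≤ (ξ 0) ^ 2 →
      (∀ (M : ℕ) (z : Fin M → E3) (c : Fin M), Function.Injective z →
          Set.range z = {x : E3 | dist x (z c) ≤ 133 / 10 ∧ ∃ a : Fin 3 → ℤ,
            x = z c + latPt U hexFrame a ∨ x = z c + latPt U hexFrame a + U (hcpShift + ξ)} →
          TightNearCap (9 / 5) (3 / 2) z c ∨ ExemptNear (9 / 5) ExRec z c ∨ BadNearCap (9 / 5) (3 / 2) z c) ∨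
        (μ : ℝ) / SC ≤ ∑ b ∈ (Fintype.piFinset fun _ : Fin 3 => Finset.Icc (-7 : ℤ) 7).filter (fun b => b ≠ 0), effPot w₄₅ ω₄ (3 / 400) ‖latPt U hexFrame b‖ +
          ∑ b ∈ (Fintype.piFinset fun _ : Fin 3 => Finset.Icc (-7 : ℤ) 7), effPot w₄₅ ω₄ (3 / 400) ‖latPt U hexFrame b + U (hcpShift + ξ)‖)
    (hF : ∃ t : CertTree (Fin 3 × Fin 3), treeOK (entryLeafOK6RBKP μ) t rootC rootW = true)
    (hH : ∃ t : CertTree (Fin 3 × Fin 3), treeOK verdict t rootC rootW = true) : HomFloor m := by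
  obtain ⟨tF, htF⟩ := hF
  obtain ⟨tH, htH⟩ := hH
  exact homFloor_of_prunedBoxSums_selfAdjoint (fccHalf_of_entryTree6RBKP hμ htF) (hcpHalf_of_entryUTreeWedge hμ verdict hver htH)

/-- ★★★ **`(H) HomFloor (1/625)`** from the fcc ∃-tree fact of record and an hcp ∃-`U`-tree fact over any sound ξ-eliminating verdict (`μ = muRec`).
[folklore] -/
theorem homFloor_625_of_entryTrees6RBKP_U
    (verdict : (Fin 3 × Fin 3 → ℤ) → (Fin 3 × Fin 3 → ℤ) → Bool)
    (hver : ∀ c w, verdict c w = true → ∀ (U : E3 →L[ℝ] E3) (ξ : E3), (∀ v v' : E3, ⟪U v, v'⟫ = ⟪v, U v'⟫) → ‖U - 1‖ ≤ 1 / 4 →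
      (∀ ab : Fin 3 × Fin 3, |(U (EuclideanSpace.single ab.2 (1 : ℝ))) ab.1 - (c ab : ℝ) / SC| ≤ (w ab : ℝ) / SC) →
      ‖ξ‖ ≤ 1 / 4 → 0 ≤ ξ 0 → 0 ≤ ξ 2 → 3 * (ξ 1) ^ 2 ≤ (ξ 0) ^ 2 →
      (∀ (M : ℕ) (z : Fin M → E3) (c : Fin M), Function.Injective z →
          Set.range z = {x : E3 | dist x (z c) ≤ 133 / 10 ∧ ∃ a : Fin 3 → ℤ,
            x = z c + latPt U hexFrame a ∨ x = z c + latPt U hexFrame a + U (hcpShift + ξ)} →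
          TightNearCap (9 / 5) (3 / 2) z c ∨ ExemptNear (9 / 5) ExRec z c ∨ BadNearCap (9 / 5) (3 / 2) z c) ∨
        (muRec : ℝ) / SC ≤ ∑ b ∈ (Fintype.piFinset fun _ : Fin 3 => Finset.Icc (-7 : ℤ) 7).filter (fun b => b ≠ 0), effPot w₄₅ ω₄ (3 / 400) ‖latPt U hexFrame b‖ +
          ∑ b ∈ (Fintype.piFinset fun _ : Fin 3 => Finset.Icc (-7 : ℤ) 7), effPot w₄₅ ω₄ (3 / 400) ‖latPt U hexFrame b + U (hcpShift + ξ)‖)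
    (hF : ∃ t : CertTree (Fin 3 × Fin 3), treeOK (entryLeafOK6RBKP muRec) t rootC rootW = true)
    (hH : ∃ t : CertTree (Fin 3 × Fin 3), treeOK verdict t rootC rootW = true) : HomFloor (1 / 625) :=
  homFloor_of_entryTrees6RBKP_U muRec_ok verdict hver hF hH

end Summit.AtomisticToContinuum.Crystallization.Theorems.FrustratedLawDichotomyStrainedPatchHomEntryUTreeHcp
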